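import Summits.FinalStateConjecture.FinalStateConjecture.Theorems.ClusterCompletenessOmegaLimitMultiKerrTranslates
import HarnessLib

/-!
# Route ClusterCompleteness · crux `OmegaLimitMultiKerr` — ω-limits come in ETERNAL families:
# the time-translates of an ω-limit are the ω-limits along the shifted times

Structure lemma for the crux stmt-FinalStateConjecture-14664 (`ClusterCompleteness.OmegaLimitMultiKerr`,
rank 9), line `Sketch`, lead gen 3. If `g` is the `Cᵏ_loc` ω-limit of the translates
`h (· + T n • e)` on a domain `O` invariant under ALL translations `x ↦ x + s • e` (the boosted Kerr
exterior under its Killing translation, `add_smul_mem_boostedKerrBackground_domain`), then for every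
`s` the translates along the SHIFTED times `T n + s` converge to the shifted field `g (· + s • e)`, on
every compact of `O`. So one ω-limit already encodes an eternal object — a field on the whole of
`O ≅ ℝ × (slab)`, read at all chart times `s ∈ ℝ`, past and future — which is the form in which
two-sided rigidity statements (stationary / non-radiating eternal vacuum exteriors) are applied in
the identification step; and the ω-limit SET along `T` is carried to the ω-limit set along `T + s`
by the shift (Hale 1980, Ch. I, §8: invariance of ω-limit sets). Pure bookkeeping over
`supCkENorm_comp_add_right`.
-/

-- every `Summit.FinalStateConjecture.FinalStateConjecture.…` name repeats the summit = sub-problem segment (D-0017 layout)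
set_option linter.dupNamespace false

noncomputable section

open Set Filter Topology Function
open scoped ContDiff Topology ENNReal

namespace Summit.FinalStateConjecture.FinalStateConjecture.Theorems.ClusterCompleteness

open Literature.Geometry.Lorentzian

/-- **Shifted times, shifted limit.** On a domain `O` invariant under all translations
`x ↦ x + s • e`: if `supCkENorm K k (h (· + T n • e) − g) → 0` for every compact `K ⊆ O`, then for
every `s`, `supCkENorm K k (h (· + (T n + s) • e) − g (· + s • e)) → 0` for every compact `K ⊆ O`
(the ω-limit along `T + s` is the `s`-translate of the ω-limit along `T`; Hale 1980, Ch. I, §8).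
[cite: Hale1980, Ch. I §8] -/
theorem tendsto_supCkENorm_translate_add_shift :
    ∀ {E : Type*} [NormedAddCommGroup E] [NormedSpace ℝ E]
      {W : Type*} [NormedAddCommGroup W] [NormedSpace ℝ W] {O : Set E} {e : E},
      (∀ x ∈ O, ∀ s : ℝ, x + s • e ∈ O) →
      ∀ {k : ℕ} {h g : E → W} {T : ℕ → ℝ},
      (∀ K ⊆ O, IsCompact K →
        Tendsto (fun n ↦ supCkENorm K k (fun x ↦ h (x + T n • e) - g x)) atTop (𝓝 0)) →
      ∀ (s : ℝ), ∀ K ⊆ O, IsCompact K →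
        Tendsto (fun n ↦ supCkENorm K k (fun x ↦ h (x + (T n + s) • e) - g (x + s • e)))
          atTop (𝓝 0) := by
  intro E _ _ W _ _ O e hO k h g T hlim s K hKO hK
  -- the shifted compact set
  have hK' : IsCompact ((fun x : E ↦ x + s • e) '' K) := hK.image (continuous_id.add continuous_const)
  have hK'O : (fun x : E ↦ x + s • e) '' K ⊆ O := by
    rintro _ ⟨x, hx, rfl⟩
    exact hO x (hKO hx) s
  have h1 := hlim _ hK'O hK'
  refine h1.congr fun n ↦ ?_
  -- `x ↦ F (x + s • e)` with `F y = h (y + T n • e) - g y`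
  have heq : (fun x ↦ h (x + (T n + s) • e) - g (x + s • e)) =
      fun x ↦ (fun y ↦ h (y + T n • e) - g y) (x + s • e) := by
    funext x
    simp only [add_smul, add_assoc, add_comm (s • e) (T n • e)]
  rw [heq]
  exact (supCkENorm_comp_add_right K k (fun y ↦ h (y + T n • e) - g y) (s • e)).symm

/-- **Eternal reading at a point**: under the same hypotheses the shifted translates converge
pointwise, `h (x + (T n + s) • e) → g (x + s • e)` for every `x ∈ O` and every `s` (order-zero term).
[cite: Hale1980, Ch. I §8] -/
theorem tendsto_translate_add_shift_apply :
    ∀ {E : Type*} [NormedAddCommGroup E] [NormedSpace ℝ E]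
      {W : Type*} [NormedAddCommGroup W] [NormedSpace ℝ W] {O : Set E} {e : E},
      (∀ x ∈ O, ∀ s : ℝ, x + s • e ∈ O) →
      ∀ {k : ℕ} {h g : E → W} {T : ℕ → ℝ},
      (∀ K ⊆ O, IsCompact K →
        Tendsto (fun n ↦ supCkENorm K k (fun x ↦ h (x + T n • e) - g x)) atTop (𝓝 0)) →
      ∀ (s : ℝ), ∀ x ∈ O,
        Tendsto (fun n ↦ h (x + (T n + s) • e)) atTop (𝓝 (g (x + s • e))) := by
  intro E _ _ W _ _ O e hO k h g T hlim s x hx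
  have h1 := tendsto_supCkENorm_translate_add_shift hO hlim s {x} (singleton_subset_iff.2 hx)
    isCompact_singleton
  -- order-zero term of the sup norm at the point `x`
  have h3 : Tendsto (fun n ↦ ‖h (x + (T n + s) • e) - g (x + s • e)‖ₑ) atTop (𝓝 0) := by
    refine tendsto_of_tendsto_of_tendsto_of_le_of_le tendsto_const_nhds h1
      (fun _ ↦ zero_le) fun n ↦ ?_
    have hle := enorm_iteratedFDeriv_le_supCkENorm (Nat.zero_le k) (mem_singleton x)
      (fun y ↦ h (y + (T n + s) • e) - g (y + s • e))
    have e0 : ‖iteratedFDeriv ℝ 0 (fun y ↦ h (y + (T n + s) • e) - g (y + s • e)) x‖ₑ =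
        ‖h (x + (T n + s) • e) - g (x + s • e)‖ₑ := by
      rw [enorm_eq_nnnorm, enorm_eq_nnnorm]
      exact congrArg _ (NNReal.eq (by simp only [coe_nnnorm, norm_iteratedFDeriv_zero]))
    exact e0 ▸ hle
  exact tendsto_sub_nhds_zero_iff.1 (tendsto_zero_iff_enorm_tendsto_zero.2 h3)

end Summit.FinalStateConjecture.FinalStateConjecture.Theorems.ClusterCompleteness

end
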